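import Mathlib.NumberTheory.NumberField.Basic
import Mathlib.NumberTheory.Padics.RingHoms
import Mathlib.RingTheory.DedekindDomain.AdicValuation
import HarnessLib

/-!
# Valuations of a number field at a principal prime through an embedding into `ℚ_p`

Let `K` be a number field, `ι : K →+* ℚ_p` a ring homomorphism, and `π ∈ 𝓞 K` a generator of a
maximal ideal `(π)` with `v_p(ι π) = 1`. Then the `(π)`-adic valuation of `𝓞 K` is read off in
`ℚ_p` through `ι`:

* `norm_embedding_le_one`: `ι(𝓞 K) ⊆ ℤ_p` (integrality; `ℤ_p` is integrally closed), so
  `toPadicInt ι : 𝓞 K →+* ℤ_p`;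
* `comap_maximalIdeal_eq_span`: the prime `ι⁻¹(p ℤ_p) ∩ 𝓞 K` is `(π)` as soon as it contains
  `π` (maximality), hence `valuation_embedding_eq_zero_of_not_dvd`: `v_p(ι w) = 0` for `π ∤ w`;
* `log_intValuation_eq_neg_valuation_embedding`, `log_valuation_eq_neg_valuation_embedding`:
  **`ord_(π)(z) = v_p(ι z)`** for `z ∈ Kˣ` (writing `r = πᵏ w`, `π ∤ w`).

This is the dictionary between the primes of `𝓞 K` above a split prime `p` and the embeddings
`K →+* ℚ_p`, in the elementary form needed to feed the `2`-adic / `5`-adic parity bits of the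
`2`-descents over `ℚ(√41)`, `ℚ(√73)`, `ℚ(√-1)` (T. Dokchitser–V. Dokchitser, *A note on the
Mordell–Weil rank modulo n*, J. Number Theory 131 (2011), proof of Thm. 2) into the ideal-theoretic
"even valuation at every prime" hypothesis of the class-number-one square theorem.

Theorems and one definition (`toPadicInt`); no named facts.

## References

* J. Neukirch, *Algebraic Number Theory* (1999), Ch. II §8 (extensions of valuations and
  embeddings into completions; Prop. 8.2 / 8.3). [folklore]
-/

noncomputable section

open IsDedekindDomain IsDedekindDomain.HeightOneSpectrum WithZero NumberField

namespace Literature.NumberTheory.NumberFields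

variable {K : Type*} [Field K] {p : ℕ} [hp : Fact p.Prime]

/-! ### Integrality: `ι(𝓞 K) ⊆ ℤ_p` -/

/-- An embedding `K →+* ℚ_p` maps algebraic integers into `ℤ_p` (`ℤ_p` is integrally closed in
`ℚ_p`). [folklore] -/
theorem norm_embedding_le_one (ι : K →+* ℚ_[p]) (r : 𝓞 K) : ‖ι (r : K)‖ ≤ 1 := by
  have h1 : IsIntegral ℤ (ι (r : K)) := (RingOfIntegers.isIntegral_coe r).map ι.toIntAlgHom
  have h2 : IsIntegral ℤ_[p] (ι (r : K)) := h1.tower_top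
  obtain ⟨y, hy⟩ := IsIntegrallyClosed.isIntegral_iff.mp h2
  rw [← hy]
  exact y.2

/-- The embedding restricted to `𝓞 K`, with values in `ℤ_p`. [folklore] -/
def toPadicInt (ι : K →+* ℚ_[p]) : 𝓞 K →+* ℤ_[p] where
  toFun r := ⟨ι (r : K), norm_embedding_le_one ι r⟩
  map_one' := by apply PadicInt.ext; simp
  map_mul' x y := by apply PadicInt.ext; simp
  map_zero' := by apply PadicInt.ext; simp
  map_add' x y := by apply PadicInt.ext; simp

/-- The value of `toPadicInt` in `ℚ_p`. [folklore] -/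
@[simp] theorem coe_toPadicInt (ι : K →+* ℚ_[p]) (r : 𝓞 K) :
    ((toPadicInt ι r : ℤ_[p]) : ℚ_[p]) = ι (r : K) := rfl

/-- The valuation of the image of an algebraic integer is `≥ 0`. [folklore] -/
theorem valuation_embedding_nonneg (ι : K →+* ℚ_[p]) (r : 𝓞 K) : 0 ≤ (ι (r : K)).valuation := by
  have := (toPadicInt ι r).valuation_coe_nonneg
  rwa [coe_toPadicInt] at this

/-- A `p`-adic number of norm `1` has valuation `0`. [folklore] -/
theorem valuation_eq_zero_of_norm_eq_one {t : ℚ_[p]} (h : ‖t‖ = 1) : t.valuation = 0 := by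
  have ht : t ≠ 0 := fun h0 => by rw [h0, norm_zero] at h; exact zero_ne_one h
  have h1 := Padic.norm_eq_zpow_neg_valuation ht
  rw [h] at h1
  have hp1 : (1 : ℝ) < p := by exact_mod_cast hp.out.one_lt
  have h2 : (p : ℝ) ^ (0 : ℤ) = (p : ℝ) ^ (-t.valuation) := by rw [zpow_zero]; exact h1
  have := zpow_right_injective₀ (by positivity) hp1.ne' h2
  omega

/-- A `p`-adic number of norm `< 1`... of valuation `≥ 1` has norm `< 1`. [folklore] -/
theorem norm_lt_one_of_one_le_valuation {t : ℚ_[p]} (ht : t ≠ 0) (h : 1 ≤ t.valuation) :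
    ‖t‖ < 1 := by
  rw [Padic.norm_eq_zpow_neg_valuation ht]
  have hp1 : (1 : ℝ) < p := by exact_mod_cast hp.out.one_lt
  calc (p : ℝ) ^ (-t.valuation) ≤ (p : ℝ) ^ (-1 : ℤ) := zpow_le_zpow_right₀ hp1.le (by omega)
    _ < 1 := by rw [zpow_neg_one]; exact inv_lt_one_of_one_lt₀ hp1

/-! ### The prime of an embedding -/

/-- **The prime of `𝓞 K` cut out by `ι`** is `(π)` as soon as `(π)` is maximal and `v_p(ι π) ≥ 1`:
`ι⁻¹(pℤ_p) ∩ 𝓞 K = (π)`. [folklore] -/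
theorem comap_maximalIdeal_eq_span (ι : K →+* ℚ_[p]) {π : 𝓞 K}
    (hmax : (Ideal.span {π}).IsMaximal) (hπ : 1 ≤ (ι (π : K)).valuation) :
    Ideal.comap (toPadicInt ι) (IsLocalRing.maximalIdeal ℤ_[p]) = Ideal.span {π} := by
  have hprime : (Ideal.comap (toPadicInt ι) (IsLocalRing.maximalIdeal ℤ_[p])).IsPrime :=
    Ideal.comap_isPrime _ _
  symm
  refine hmax.eq_of_le hprime.ne_top ((Ideal.span_singleton_le_iff_mem _).mpr ?_)
  rw [Ideal.mem_comap, IsLocalRing.mem_maximalIdeal, mem_nonunits_iff, PadicInt.isUnit_iff]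
  have hπ0 : ι (π : K) ≠ 0 := by
    intro h0; rw [h0, Padic.valuation_zero] at hπ; exact absurd hπ (by norm_num)
  have := norm_lt_one_of_one_le_valuation hπ0 hπ
  change ‖ι (π : K)‖ ≠ 1
  exact this.ne

/-- Off the prime `(π)` the embedding is a unit: `π ∤ w ⟹ v_p(ι w) = 0`. [folklore] -/
theorem valuation_embedding_eq_zero_of_not_dvd (ι : K →+* ℚ_[p]) {π : 𝓞 K}
    (hmax : (Ideal.span {π}).IsMaximal) (hπ : 1 ≤ (ι (π : K)).valuation) {w : 𝓞 K}
    (hw : ¬ π ∣ w) : (ι (w : K)).valuation = 0 := by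
  have hmem : w ∉ Ideal.comap (toPadicInt ι) (IsLocalRing.maximalIdeal ℤ_[p]) := by
    rw [comap_maximalIdeal_eq_span ι hmax hπ, Ideal.mem_span_singleton]
    exact hw
  rw [Ideal.mem_comap, IsLocalRing.mem_maximalIdeal, mem_nonunits_iff, not_not,
    PadicInt.isUnit_iff] at hmem
  exact valuation_eq_zero_of_norm_eq_one hmem

/-! ### `ord_(π) = v_p ∘ ι` -/

section NumberField

variable [NumberField K]

/-- **The `(π)`-adic valuation through the embedding, integral version**: if `(π)` is maximal and
`v_p(ι π) = 1`, then for `r ∈ 𝓞 K`, `r ≠ 0`, `log (ord_(π) r) = -v_p(ι r)` (Mathlib's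
`intValuation` is written multiplicatively, `exp (-ord)`). [folklore] -/
theorem log_intValuation_eq_neg_valuation_embedding (ι : K →+* ℚ_[p]) {π : 𝓞 K}
    (hmax : (Ideal.span {π}).IsMaximal) (hπ : (ι (π : K)).valuation = 1)
    (v : HeightOneSpectrum (𝓞 K)) (hv : v.asIdeal = Ideal.span {π}) {r : 𝓞 K} (hr : r ≠ 0) :
    log (v.intValuation r) = -(ι (r : K)).valuation := by
  have hπu : ¬ IsUnit π := fun hu =>
    hmax.ne_top (Ideal.span_singleton_eq_top.mpr hu)
  have hπ0 : π ≠ 0 := by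
    rintro rfl
    rw [show ((0 : 𝓞 K) : K) = 0 from rfl, map_zero, Padic.valuation_zero] at hπ
    exact zero_ne_one hπ
  obtain ⟨k, w, hw, rfl⟩ := WfDvdMonoid.max_power_factor' hr hπu
  have hw0 : w ≠ 0 := by rintro rfl; exact hr (mul_zero _)
  -- the ideal-theoretic side
  have hvπ : v.intValuation π = exp (-1 : ℤ) := intValuation_singleton _ hπ0 hv
  have hvw : v.intValuation w = 1 := by
    rw [intValuation_eq_one_iff, hv, Ideal.mem_span_singleton]; exact hw
  have h1 : log (v.intValuation (π ^ k * w)) = -k := by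
    rw [map_mul, map_pow, hvπ, hvw, mul_one, ← exp_nsmul, log_exp]; simp
  -- the `p`-adic side
  have hιπ : ι (π : K) ≠ 0 := by
    intro h0; rw [h0, Padic.valuation_zero] at hπ; exact zero_ne_one hπ
  have hιw : ι (w : K) ≠ 0 := by
    rw [map_ne_zero, RingOfIntegers.coe_eq_algebraMap, RingOfIntegers.coe_ne_zero_iff]; exact hw0
  have h2 : (ι ((π ^ k * w : 𝓞 K) : K)).valuation = k := by
    rw [show ((π ^ k * w : 𝓞 K) : K) = (π : K) ^ k * (w : K) by push_cast; rfl, map_mul, map_pow,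
      Padic.valuation_mul (pow_ne_zero _ hιπ) hιw, Padic.valuation_pow, hπ,
      valuation_embedding_eq_zero_of_not_dvd ι hmax (by rw [hπ]) hw]
    ring
  rw [h1, h2]

/-- **The `(π)`-adic valuation through the embedding**: for `z ∈ Kˣ`,
`log (ord_(π) z) = -v_p(ι z)`. [folklore] -/
theorem log_valuation_eq_neg_valuation_embedding (ι : K →+* ℚ_[p]) {π : 𝓞 K}
    (hmax : (Ideal.span {π}).IsMaximal) (hπ : (ι (π : K)).valuation = 1)
    (v : HeightOneSpectrum (𝓞 K)) (hv : v.asIdeal = Ideal.span {π}) {z : K} (hz : z ≠ 0) :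
    log (v.valuation K z) = -(ι z).valuation := by
  obtain ⟨a, b, hb, rfl⟩ := IsFractionRing.div_surjective (A := 𝓞 K) z
  have hb0 : b ≠ 0 := nonZeroDivisors.ne_zero hb
  have ha0 : a ≠ 0 := by
    rintro rfl; rw [map_zero, zero_div] at hz; exact hz rfl
  have hva : v.intValuation a ≠ 0 := v.intValuation_ne_zero a ha0
  have hvb : v.intValuation b ≠ 0 := v.intValuation_ne_zero b hb0
  have hιa : ι (algebraMap (𝓞 K) K a) ≠ 0 := by
    rw [map_ne_zero, RingOfIntegers.coe_ne_zero_iff]; exact ha0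
  have hιb : ι (algebraMap (𝓞 K) K b) ≠ 0 := by
    rw [map_ne_zero, RingOfIntegers.coe_ne_zero_iff]; exact hb0
  rw [Valuation.map_div, valuation_of_algebraMap, valuation_of_algebraMap, log_div hva hvb,
    log_intValuation_eq_neg_valuation_embedding ι hmax hπ v hv ha0,
    log_intValuation_eq_neg_valuation_embedding ι hmax hπ v hv hb0, map_div₀, div_eq_mul_inv,
    Padic.valuation_mul hιa (inv_ne_zero hιb), Padic.valuation_inv]
  rw [← RingOfIntegers.coe_eq_algebraMap, ← RingOfIntegers.coe_eq_algebraMap]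
  ring

end NumberField

end Literature.NumberTheory.NumberFields

end
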